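import Literature.NumberTheory.Sieve.LinearEquationsInPrimesWTrick
import Summits.Parity.GeneralizedHardyLittlewood.Theorems.LeeYangFibresFibrationLemmaDisc
import HarnessLib

/-!
# Fibration lemma (`DimOne → GeneralizedHardyLittlewood`): the lift to non-vanishing last coefficients

Support file for the statement item `FibrationLemma : DimOne → GeneralizedHardyLittlewood`
(stmt-Parity-0822, shared; here for route `LeeYangFibres`, whose `Assembly` (stmt-Parity-14612) composes
through it). The fibration argument of Green–Tao (2010, §1, remark after Conj. 1.2, "holding `d − 1` of the
variables fixed and summing in the remaining one") fibres a system on `ℤ^{d+1}` over its first `d`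
coordinates (`LeeYangFibresFibrationLemmaDefs`), and needs every form to have a NON-ZERO LAST
COEFFICIENT `ψ̇ᵢ(e_{d+1})` for the fibres to be legitimate `d = 1` systems. This file supplies the
reduction of the general conjecture to that case:

* `exists_linearPart_ne_zero` — for a system with non-zero linear parts there is a lattice vector
  `g ∈ [-t, t]^d` with `ψ̇ᵢ(g) ≠ 0` for every `i` (counting: a non-zero form vanishes on at most
  `(2t+1)^{d-1}` of the `(2t+1)^d` points of the box, `card_filter_eval_eq_zero_le`,
  `card_latticeBox`);
* the extension `Ψ'(n, m) = Ψ(n + m g)` on `ℤ^{d+1}` (Green–Tao's Lemma 4.4 device, tree: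
  `AffLinForm.extendAlong`, `β'_p = β_p`, `‖Ψ'‖ = O(1)`) then has last coefficients `ψ̇ᵢ(g) ≠ 0`
  (`extendAlong_coeff_last`);
* over the PADDED body `K' = {(x, m) : |m| ≤ N + ½, x + m g ∈ K}` (`extBody g (N + ½) K`) both the prime
  sum and the archimedean factor scale by EXACTLY `2N + 1`:
  `vonMangoldtSum_padBody` (the lattice points of `K'` are those of `extBody g N K`, in bijection with
  `[-N, N] × (K ∩ ℤ^d)`, tree: `vonMangoldtSum_extendAlong_extBody`) and `archFactor_padBody` (Fubini after
  the volume-preserving shear `(m, x) ↦ (m, x + m g)`), so NO bound on the singular product is needed;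
* `lift` — for a fixed dimension `d`: the conjecture for all `(d+1)`-dimensional systems with non-zero
  last coefficients implies the conjecture for all `d`-dimensional systems;
* `generalizedHardyLittlewood_of_lastCoeff` — hence the restricted conjecture in all dimensions `≥ 2`
  implies `GeneralizedHardyLittlewood`.

References: B. Green, T. Tao, *Linear equations in primes*, Ann. of Math. 171 (2010), §1 (Conj. 1.2 and
the remark following it) and §4 (Lemma 4.4, proof of the Main Theorem assuming Thm. 4.5) [GreenTao2010].
No named facts are used.
-/

noncomputable section

open Finset MeasureTheory

namespace Summit.Parity.GeneralizedHardyLittlewood.Theorems.FibrationLift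

open Literature.NumberTheory.Sieve

variable {d t : ℕ}

/-! ### A lattice direction on which no linear part vanishes -/

/-- **A direction on which no linear part vanishes.** If every form of `Ψ = (ψ₁, …, ψ_t)` on `ℤ^d`
has a non-zero linear part, there is `g ∈ [-t, t]^d ∩ ℤ^d` with `ψ̇ᵢ(g) ≠ 0` for all `i`: each
`ψ̇ᵢ` vanishes on at most `(2t+1)^{d-1}` points of the box, and `t (2t+1)^{d-1} < (2t+1)^d`.
[cite: GreenTao2010, §1 (remark after Conj. 1.2)] -/
theorem exists_linearPart_ne_zero (Ψ : Fin t → AffLinForm d) (hΨ : ∀ i, (Ψ i).coeff ≠ 0) :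
    ∃ g : Fin d → ℤ, (∀ j, (g j).natAbs ≤ t) ∧ ∀ i, (Ψ i).linearPart g ≠ 0 := by
  classical
  cases d with
  | zero =>
    refine ⟨fun j => j.elim0, fun j => j.elim0, fun i => ?_⟩
    exact absurd (Subsingleton.elim _ _) (hΨ i)
  | succ d =>
    set S := latticeBox (d + 1) t with hS
    set bad := S.filter (fun w => ∃ i, (Ψ i).linearPart w = 0) with hbad
    have hlin : ∀ i w, (⟨(Ψ i).coeff, 0⟩ : AffLinForm (d + 1)).eval w = (Ψ i).linearPart w := by
      intro i w
      simp [AffLinForm.eval, AffLinForm.linearPart]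
    have hbad_le : #bad ≤ t * (2 * t + 1) ^ d := by
      calc #bad ≤ #(Finset.univ.biUnion fun i : Fin t =>
              S.filter (fun w => (⟨(Ψ i).coeff, 0⟩ : AffLinForm (d + 1)).eval w = 0)) := by
            refine Finset.card_le_card fun w hw => ?_
            obtain ⟨hwS, i, hi⟩ := Finset.mem_filter.mp hw
            exact Finset.mem_biUnion.mpr ⟨i, Finset.mem_univ _,
              Finset.mem_filter.mpr ⟨hwS, by rw [hlin]; exact hi⟩⟩
        _ ≤ ∑ i : Fin t, #(S.filter
              (fun w => (⟨(Ψ i).coeff, 0⟩ : AffLinForm (d + 1)).eval w = 0)) :=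
            Finset.card_biUnion_le
        _ ≤ ∑ _i : Fin t, (2 * t + 1) ^ d := Finset.sum_le_sum fun i _ => by
            have := card_filter_eval_eq_zero_le (⟨(Ψ i).coeff, 0⟩ : AffLinForm (d + 1))
              (Or.inl (hΨ i)) t
            simpa using this
        _ = t * (2 * t + 1) ^ d := by simp
    have hlt : #bad < #S := by
      rw [hS, card_latticeBox, pow_succ]
      have hpos : 0 < (2 * t + 1) ^ d := pow_pos (by omega) d
      calc #bad ≤ t * (2 * t + 1) ^ d := hbad_le
        _ < (2 * t + 1) ^ d * (2 * t + 1) := by nlinarith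
    obtain ⟨g, hgS, hgbad⟩ := Finset.exists_mem_notMem_of_card_lt_card hlt
    refine ⟨g, fun j => ?_, fun i hi => hgbad (Finset.mem_filter.mpr ⟨hgS, i, hi⟩)⟩
    have hj := Finset.mem_Icc.mp (Fintype.mem_piFinset.mp hgS j)
    have : |g j| ≤ (t : ℤ) := abs_le.mpr hj
    rw [Int.abs_eq_natAbs] at this
    exact_mod_cast this

/-! ### The extension along one direction -/

/-- The new variable of `ℤ^{d+1} = ℤ^d × ℤ` is the last coordinate. [folklore] -/
theorem natAdd_eq_last (l : Fin 1) : Fin.natAdd d l = Fin.last d := by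
  ext
  simp [Fin.natAdd, Fin.eq_zero l]

/-- The last coefficient of the extension `ψ'(n, m) = ψ(n + m g)` is `ψ̇(g)`.
[cite: GreenTao2010, proof of Lemma 4.4] -/
theorem extendAlong_coeff_last (ψ : AffLinForm d) (g : Fin d → ℤ) :
    (ψ.extendAlong (fun _ : Fin 1 => g)).coeff (Fin.last d) = ψ.linearPart g := by
  rw [← natAdd_eq_last (0 : Fin 1), AffLinForm.extendAlong_coeff_natAdd]

/-- `extShiftReal (fun _ => g) v = (v₀, …, v_{d-1}) + v_d g`. [folklore] -/
theorem extShiftReal_dir (g : Fin d → ℤ) (v : Fin (d + 1) → ℝ) :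
    extShiftReal (fun _ : Fin 1 => g) v = fun j => v (Fin.castSucc j) + v (Fin.last d) * (g j : ℝ) := by
  funext j
  simp [extShiftReal, natAdd_eq_last]
  rfl

/-! ### The padded body: lattice sums -/

open Classical in
/-- The lattice points of the padded body `extBody g (N + ½) K` are those of `extBody g N K`
(an integer `m` has `|m| ≤ N + ½` iff `|m| ≤ N`). [folklore] -/
theorem filter_padBody_eq (g : Fin d → ℤ) (N N' : ℕ) (K : Set (Fin d → ℝ)) :
    (latticeBox (d + 1) N').filter
        (fun v => realPoint v ∈ extBody (fun _ : Fin 1 => g) ((N : ℝ) + 1 / 2) K) =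
      (latticeBox (d + 1) N').filter (fun v => realPoint v ∈ extBody (fun _ : Fin 1 => g) (N : ℝ) K) := by
  refine Finset.filter_congr fun v _ => ?_
  simp only [extBody, Set.mem_setOf_eq]
  refine and_congr_left fun _ => forall_congr' fun l => ?_
  have hcast : |realPoint v (Fin.natAdd d l)| = ((|v (Fin.natAdd d l)| : ℤ) : ℝ) := by
    simp [realPoint]
  rw [hcast]
  constructor
  · intro h
    have h' : |v (Fin.natAdd d l)| ≤ (N : ℤ) := by
      by_contra hc
      have hc' : (N : ℤ) + 1 ≤ |v (Fin.natAdd d l)| := by omega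
      have : ((N : ℝ) + 1) ≤ ((|v (Fin.natAdd d l)| : ℤ) : ℝ) := by exact_mod_cast hc'
      linarith
    exact_mod_cast h'
  · intro h
    have : ((|v (Fin.natAdd d l)| : ℤ) : ℝ) ≤ N := by exact_mod_cast (show _ from by exact_mod_cast h)
    linarith

/-- **The prime sum over the padded body** is exactly `2N + 1` times the prime sum over `K`:
`∑_{(n,m) ∈ K' ∩ ℤ^{d+1}} ∏ᵢ Λ(ψ'ᵢ(n, m)) = (2N+1) ∑_{r ∈ K ∩ ℤ^d} ∏ᵢ Λ(ψᵢ(r))` (the change of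
variables `r = n + m g`, `m ∈ [-N, N]`). [cite: GreenTao2010, §4 (proof of the Main Theorem assuming
Theorem 4.5)] -/
theorem vonMangoldtSum_padBody (Ψ : Fin t → AffLinForm d) {g : Fin d → ℤ} {B : ℕ}
    (hg : ∀ j, (g j).natAbs ≤ B) {N N' : ℕ} (hN' : (1 + B) * N ≤ N') {K : Set (Fin d → ℝ)}
    (hK : K ⊆ realBox d N) :
    vonMangoldtSum (fun i => (Ψ i).extendAlong (fun _ : Fin 1 => g)) (extBody (fun _ : Fin 1 => g) ((N : ℝ) + 1 / 2) K) N' =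
      (2 * N + 1) * vonMangoldtSum Ψ K N := by
  have h := vonMangoldtSum_extendAlong_extBody Ψ (fun _ : Fin 1 => g) (B := B) (fun _ j => hg j) (N := N)
    (N' := N') (by simpa using hN') hK
  rw [pow_one] at h
  rw [← h]
  unfold vonMangoldtSum
  rw [filter_padBody_eq]

/-! ### The padded body: the archimedean factor -/

/-- The positive part of the padded body is the padded body of the positive part:
`K' ∩ {Ψ' > 0} = {v : |v_d| ≤ R, extShift v ∈ K ∩ {Ψ > 0}}`. [folklore] -/
theorem posBody_extBody (Ψ : Fin t → AffLinForm d) (g : Fin d → ℤ) (R : ℝ) (K : Set (Fin d → ℝ)) :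
    posBody (fun i => (Ψ i).extendAlong (fun _ : Fin 1 => g)) 0 (extBody (fun _ : Fin 1 => g) R K) =
      extBody (fun _ : Fin 1 => g) R (posBody Ψ 0 K) := by
  ext v
  simp only [posBody, extBody, Set.mem_inter_iff, Set.mem_setOf_eq, AffLinForm.extendAlong_realEval]
  tauto

/-- The shear `(m, x) ↦ (m, m g + x)` of `ℝ × ℝ^d` preserves Lebesgue measure (translations preserve
the measure of each fibre). [folklore] -/
theorem measurePreserving_shear (w : Fin d → ℝ) :
    MeasurePreserving (fun p : ℝ × (Fin d → ℝ) => (p.1, p.1 • w + p.2))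
      ((volume : Measure ℝ).prod (volume : Measure (Fin d → ℝ)))
      ((volume : Measure ℝ).prod (volume : Measure (Fin d → ℝ))) := by
  refine (MeasurePreserving.id (volume : Measure ℝ)).skew_product
    (g := fun m x => m • w + x) ?_ (Filter.Eventually.of_forall fun m => ?_)
  · exact ((continuous_fst.smul continuous_const).add continuous_snd).measurable
  · exact map_add_left_eq_self volume (m • w)

/-- **The archimedean factor of the padded body** is exactly `2R` times that of `K`:
`vol_{d+1}(K' ∩ {Ψ' > 0}) = 2R · vol_d(K ∩ {Ψ > 0})` for `K' = extBody g R K`, `R ≥ 0` — split off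
the last coordinate (`piFinSuccAbove`), undo the volume-preserving shear, and use Fubini on the
product `[-R, R] × (K ∩ {Ψ > 0})`. [cite: GreenTao2010, (1.4)] -/
theorem archFactor_padBody (Ψ : Fin t → AffLinForm d) (g : Fin d → ℤ) {R : ℝ} (hR : 0 ≤ R)
    {K : Set (Fin d → ℝ)} (hK : Convex ℝ K) :
    archFactor (fun i => (Ψ i).extendAlong (fun _ : Fin 1 => g)) (extBody (fun _ : Fin 1 => g) R K) = 2 * R * archFactor Ψ K := by
  rw [archFactor_eq_volume_posBody, archFactor_eq_volume_posBody, posBody_extBody]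
  set K₀ := posBody Ψ 0 K with hK₀
  set w : Fin d → ℝ := fun j => (g j : ℝ) with hw
  -- the coordinate splitting `v ↦ (v_d, (v₀, …, v_{d-1}))`
  set e := MeasurableEquiv.piFinSuccAbove (fun _ : Fin (d + 1) => ℝ) (Fin.last d) with he
  have hev : ∀ v : Fin (d + 1) → ℝ, e v = (v (Fin.last d), Fin.init v) := by
    intro v
    simp [he, MeasurableEquiv.piFinSuccAbove_apply]
  -- the shear
  set T : ℝ × (Fin d → ℝ) → ℝ × (Fin d → ℝ) := fun p => (p.1, p.1 • w + p.2) with hT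
  have hset : extBody (fun _ : Fin 1 => g) R K₀ = e ⁻¹' (T ⁻¹' (Set.Icc (-R) R ×ˢ K₀)) := by
    ext v
    simp only [extBody, Set.mem_setOf_eq, Set.mem_preimage, hev, hT, Set.mem_prod, Set.mem_Icc,
      abs_le]
    have h1 : (∀ l : Fin 1, -R ≤ v (Fin.natAdd d l) ∧ v (Fin.natAdd d l) ≤ R) ↔
        (-R ≤ v (Fin.last d) ∧ v (Fin.last d) ≤ R) := by
      constructor
      · intro h; simpa [natAdd_eq_last] using h 0
      · intro h l; simpa [natAdd_eq_last] using h
    have h2 : extShiftReal (fun _ : Fin 1 => g) v = v (Fin.last d) • w + Fin.init v := by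
      rw [extShiftReal_dir]
      funext j
      simp [hw, Fin.init]
      ring
    rw [h1, h2]
  rw [hset, (volume_preserving_piFinSuccAbove (fun _ : Fin (d + 1) => ℝ) (Fin.last d)).measure_preimage_equiv]
  have hK₀ : NullMeasurableSet K₀ (volume : Measure (Fin d → ℝ)) :=
    (convex_posBody Ψ 0 hK).nullMeasurableSet (μ := volume)
  have hprod : NullMeasurableSet (Set.Icc (-R) R ×ˢ K₀)
      ((volume : Measure ℝ).prod (volume : Measure (Fin d → ℝ))) :=
    measurableSet_Icc.nullMeasurableSet.prod hK₀
  rw [show (volume : Measure (ℝ × (Fin d → ℝ))) = (volume : Measure ℝ).prod volume from rfl,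
    (measurePreserving_shear w).measure_preimage hprod, Measure.prod_prod, Real.volume_Icc,
    ENNReal.toReal_mul, ENNReal.toReal_ofReal (by linarith)]
  ring

/-! ### The lift -/

/-- **The lift, one dimension at a time.** Fix `d`. If the generalised Hardy–Littlewood asymptotic
holds for every `t, L` uniformly over the non-degenerate systems `Ψ'` on `ℤ^{d+1}` of size `≤ L` ALL OF
WHOSE LAST COEFFICIENTS `ψ̇'ᵢ(e_{d+1})` ARE NON-ZERO (and all convex `K' ⊆ [-N, N]^{d+1}`), then it holds
for every non-degenerate system on `ℤ^d`: apply the hypothesis to the extension `Ψ'(n, m) = Ψ(n + m g)`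
(`g` from `exists_linearPart_ne_zero`, size `≤ t(d+1)(L + dLt) + L`) over the padded body
`K' ⊆ [-N', N']^{d+1}`, `N' = (t+1)(N+1)`, and divide the resulting inequality
`(2N+1) |Σ_K − β_∞ ∏_p β_p| ≤ ε' N'^{d+1}` by `2N + 1 ≥ N`. [cite: GreenTao2010, §1 (remark after
Conj. 1.2) and §4 (proof of the Main Theorem assuming Theorem 4.5)] -/
theorem lift (d : ℕ)
    (h : ∀ (t L : ℕ), 1 ≤ t → ∀ ε : ℝ, 0 < ε → ∃ N₀ : ℕ, ∀ N : ℕ, N₀ ≤ N →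
      ∀ Ψ : Fin t → AffLinForm (d + 1), IsNondegenerateSystem Ψ →
        (∀ i, (Ψ i).coeff (Fin.last d) ≠ 0) → affLinSize Ψ N ≤ L →
          ∀ K : Set (Fin (d + 1) → ℝ), Convex ℝ K → K ⊆ realBox (d + 1) N →
            |vonMangoldtSum Ψ K N - archFactor Ψ K * singularProduct Ψ| ≤ ε * (N : ℝ) ^ (d + 1))
    (t L : ℕ) (ht : 1 ≤ t) (ε : ℝ) (hε : 0 < ε) :
    ∃ N₀ : ℕ, ∀ N : ℕ, N₀ ≤ N →
      ∀ Ψ : Fin t → AffLinForm d, IsNondegenerateSystem Ψ → affLinSize Ψ N ≤ L →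
        ∀ K : Set (Fin d → ℝ), Convex ℝ K → K ⊆ realBox d N →
          |vonMangoldtSum Ψ K N - archFactor Ψ K * singularProduct Ψ| ≤ ε * (N : ℝ) ^ d := by
  -- constants
  set C : ℕ := 2 * (t + 1) with hC
  have hCpos : (0 : ℝ) < C := by rw [hC]; positivity
  set ε' : ℝ := ε / (C : ℝ) ^ (d + 1) with hε'
  have hε'pos : 0 < ε' := div_pos hε (pow_pos hCpos _)
  set L' : ℕ := t * (d + 1) * (L + d * L * t) + L with hL'
  obtain ⟨N₁, hN₁⟩ := h t L' ht ε' hε'pos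
  refine ⟨max N₁ 1, fun N hN Ψ hΨ hΨL K hK hKN => ?_⟩
  have hN1 : 1 ≤ N := le_of_max_le_right hN
  have hNN₁ : N₁ ≤ N := le_of_max_le_left hN
  -- the direction and the extension
  obtain ⟨g, hgt, hg⟩ := exists_linearPart_ne_zero Ψ hΨ.1
  set Ψ' : Fin t → AffLinForm (d + 1) := fun i => (Ψ i).extendAlong (fun _ : Fin 1 => g) with hΨ'
  set N' : ℕ := (t + 1) * (N + 1) with hN'
  set K' : Set (Fin (d + 1) → ℝ) := extBody (fun _ : Fin 1 => g) ((N : ℝ) + 1 / 2) K with hK'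
  have hN'ge : N ≤ N' := by
    rw [hN']; nlinarith
  have hN₁N' : N₁ ≤ N' := hNN₁.trans hN'ge
  have hΨ'nd : IsNondegenerateSystem Ψ' := isNondegenerateSystem_extendAlong hΨ (fun _ : Fin 1 => g)
  have hΨ'last : ∀ i, (Ψ' i).coeff (Fin.last d) ≠ 0 := fun i => by
    rw [hΨ', extendAlong_coeff_last]; exact hg i
  have hΨ'size : affLinSize Ψ' N' ≤ L' := by
    have := affLinSize_extendAlong_le (k := 1) (Ψ := Ψ) (L := L) (M := t) (N := (N : ℝ)) (N' := (N' : ℝ))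
      (by exact_mod_cast hN1) (by exact_mod_cast hN'ge) hΨL (f := fun _ : Fin 1 => g) (fun _ j => hgt j)
    simpa [hL'] using this
  have hK'conv : Convex ℝ K' := convex_extBody (fun _ : Fin 1 => g) _ hK
  have hK'box : K' ⊆ realBox (d + 1) N' := by
    have hKN' : K ⊆ realBox d ((N : ℝ) + 1 / 2) := by
      intro x hx
      have := hKN hx
      simp only [realBox, Set.mem_Icc, Pi.le_def] at this ⊢
      exact ⟨fun j => by linarith [this.1 j], fun j => by linarith [this.2 j]⟩
    refine extBody_subset_realBox (fun _ : Fin 1 => g) (M := t) (fun _ j => hgt j) (by positivity) ?_ hKN'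
    rw [hN']; push_cast; nlinarith
  -- the hypothesis applied to the extension over the padded body
  have key := hN₁ N' hN₁N' Ψ' hΨ'nd hΨ'last hΨ'size K' hK'conv hK'box
  have hsum : vonMangoldtSum Ψ' K' N' = (2 * N + 1) * vonMangoldtSum Ψ K N :=
    vonMangoldtSum_padBody Ψ hgt (N' := N') (by rw [hN']; nlinarith) hKN
  have harch : archFactor Ψ' K' = (2 * N + 1) * archFactor Ψ K := by
    rw [hK', archFactor_padBody Ψ g (by positivity) hK]; ring
  have hsing : singularProduct Ψ' = singularProduct Ψ := singularProduct_extendAlong Ψ (fun _ : Fin 1 => g)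
  rw [hsum, harch, hsing] at key
  have hfac : (2 * (N : ℝ) + 1) * |vonMangoldtSum Ψ K N - archFactor Ψ K * singularProduct Ψ| ≤
      ε' * (N' : ℝ) ^ (d + 1) := by
    have h2N : (0 : ℝ) ≤ 2 * N + 1 := by positivity
    have hid : (2 * (N : ℝ) + 1) * (vonMangoldtSum Ψ K N - archFactor Ψ K * singularProduct Ψ) =
        (2 * N + 1) * vonMangoldtSum Ψ K N - (2 * N + 1) * archFactor Ψ K * singularProduct Ψ := by
      ring
    rw [← abs_of_nonneg h2N, ← abs_mul, hid]
    exact key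
  -- bookkeeping: `ε' N'^{d+1} ≤ ε N^d (2N+1)`
  have hN'le : (N' : ℝ) ≤ C * N := by
    rw [hN', hC]; push_cast
    have : (N : ℝ) + 1 ≤ 2 * N := by
      have : (1 : ℝ) ≤ N := by exact_mod_cast hN1
      linarith
    nlinarith
  have hbound : ε' * (N' : ℝ) ^ (d + 1) ≤ ε * (N : ℝ) ^ d * (2 * N + 1) := by
    calc ε' * (N' : ℝ) ^ (d + 1) ≤ ε' * ((C : ℝ) * N) ^ (d + 1) := by
          refine mul_le_mul_of_nonneg_left ?_ hε'pos.le
          exact pow_le_pow_left₀ (by positivity) hN'le _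
      _ = ε * (N : ℝ) ^ d * N := by
          rw [hε', mul_pow, pow_succ]
          field_simp
          ring
      _ ≤ ε * (N : ℝ) ^ d * (2 * N + 1) := by
          refine mul_le_mul_of_nonneg_left (by linarith [(Nat.cast_nonneg N : (0 : ℝ) ≤ N)]) ?_
          positivity
  have h2Npos : (0 : ℝ) < 2 * N + 1 := by positivity
  have := hfac.trans hbound
  rw [mul_comm] at this
  exact le_of_mul_le_mul_right this h2Npos

/-- **`GeneralizedHardyLittlewood` from the case of non-vanishing last coefficients.** If, in every
dimension `d + 1 ≥ 2`, the generalised Hardy–Littlewood asymptotic holds uniformly over the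
non-degenerate systems all of whose last coefficients are non-zero, then Green–Tao's Conjecture 1.2
holds in full (dimension `d ≥ 1` is lifted from dimension `d + 1`). This is the reduction that makes the
coordinate fibration `ℤ^{d+1} → ℤ^d` of the fibration lemma applicable to an arbitrary system.
[cite: GreenTao2010, §1 (remark after Conj. 1.2)] -/
theorem generalizedHardyLittlewood_of_lastCoeff
    (h : ∀ (d t L : ℕ), 1 ≤ d → 1 ≤ t → ∀ ε : ℝ, 0 < ε → ∃ N₀ : ℕ, ∀ N : ℕ, N₀ ≤ N →
      ∀ Ψ : Fin t → AffLinForm (d + 1), IsNondegenerateSystem Ψ →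
        (∀ i, (Ψ i).coeff (Fin.last d) ≠ 0) → affLinSize Ψ N ≤ L →
          ∀ K : Set (Fin (d + 1) → ℝ), Convex ℝ K → K ⊆ realBox (d + 1) N →
            |vonMangoldtSum Ψ K N - archFactor Ψ K * singularProduct Ψ| ≤ ε * (N : ℝ) ^ (d + 1)) :
    GeneralizedHardyLittlewood := by
  intro d t L hd ht ε hε
  exact lift d (fun t L ht ε hε => h d t L hd ht ε hε) t L ht ε hε

end Summit.Parity.GeneralizedHardyLittlewood.Theorems.FibrationLift
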